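/-
Copyright (c) 2026 the pub-hodgecm-mathlib formalisation cell (harness21).  Prover seat hodgecm-mathlib-LH4-p07 (g4), req620 Track A «(D-RAM) FOUR-FRAME» squad
(heir LEAD F0P3a-plan lineage; dealer LH4-plan lineage WORD #26 (1); MS ROAD A, Stage B₂ brick B7₂ (ii)₂ «CORE-HANGING STRATA, TYPE 2 — THE POLARISATION CLASSES»;
Stage B lead LH4-p10 (g2); re-keyed on multiplicity by LH4-p11 (g2) 2026-09-04T00:53Z).  2026-09-04.
-/
import Summits.HodgeConjecture.HodgeConjecture.Theorems.F0P3cDyRamDiagonalCoreHangingCriterionTypeTwo      -- (B) (this seat): the exact set `Δ₂`; brings (A) (letters), ★ p856270, ★ p855897, ★ p855737, ★ StrataDefs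
import Summits.HodgeConjecture.HodgeConjecture.Theorems.F0P3cDyRamDiagonalGluedStabiliserIndexCorner     -- ★ p856076 (LH4-p08): `mem_fixedUnitStabilizer_latt_glued_corner_iff`; brings ★ `lineariser_of_criterionR`, ★ `ne_zero_and_v_lt_one_of_v_eq_exp`
import HarnessLib

/-!
# Crux `H413`, MS ROAD A, STAGE B₂ brick B7₂ (ii)₂: «CORE-HANGING STRATA, TYPE 2 — TWO POLARISATIONS ARE `S_F`-RELATED IFF THEIR LETTERS `f` AGREE MODULO `𝔭^{ρ+1}`»

Cell `hodgecm-mathlib` (D-0151), FLOOR 0, crux item H413 = `stmt-HodgeConjecture-24833`; lane `--supports stmt-HodgeConjecture-24833 --as helper` (count-neutral).  THEOREMS ONLY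
(no `def`, no instance, no notation, no `sorry`, default heartbeats).
THE OBJECT (★ StrataDefs ED. 3 `polarisationCosets` ∕ `polarisationCount`, LH4-p11 (g2)'s re-key 2026-09-04T00:53Z): for the core-hanging type-2 frame `V = (1 0 0; x ϖ^ρ 0; xζ+y″ ϖ^ρζ ϖ^{2ρ+1})`
(`x, ζ, y″, y = xζ+y″` units, `ρ ≥ 1`) the re-keyed head weighs `latt V` by `n₂ = #(Δ₂(latt V) ∕ S_F(latt V))`, the number of classes of type-2 polarisations under the `σ`-fixed unit
diagonal stabiliser `S_F`.  FILES (A)∕(B) (`…CoreHangingPolarisationsTypeTwo`, `…CoreHangingCriterionTypeTwo`) determined `Δ₂` by the letters `P := D₂` (`|P| = |ϖ|^{−2ρ}`),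
`f := −(D₁ + D₂Nζ)∕D₂` ((R): `|ζσy″ − σx·f| ≤ |ϖ|^ρ`), `g := (D₀ + Nx·D₁ + Ny·D₂)∕D₂` ((COF): `|f·g + B·σB| ≤ |ϖ|^{2ρ+1}`, `B := ζσy″ − σx·f`).  THIS FILE: for `D, D′ ∈ Δ₂(latt V)`,
  **`D′ ∈ D·S_F(latt V)` ⟺ `|D₁∕D₂ − D′₁∕D′₂| ≤ |ϖ|^{ρ+1}`** (equivalently `|f − f′| ≤ |ϖ|^{ρ+1}`: `D₁∕D₂ = −(Nζ + f)`)
— so the classes are the classes of the `σ`-fixed unit `f` modulo `𝔭^{ρ+1}` INSIDE its class modulo `𝔭^ρ` (which (R) fixes): `q` of them for even `ρ`, one for odd `ρ` (FILE (iii)₂).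
THE MATHEMATICS.  `S_F(latt V)` is ★ p856076 `mem_fixedUnitStabilizer_latt_glued_corner_iff` at `s = 0`, `e = 1` with the lineariser `g_ℓ = Nζ∕f` of ★ `lineariser_of_criterionR`:
`u ∈ S_F ⟺ u ∈ 𝒰 ∧ (b) |u₂ − u₁| ≤ |ϖ|^{ρ+1} ∧ (c′) |g_ℓ(u₂ − u₁) + (u₂ − u₀)| ≤ |ϖ|^{2ρ+1}`.  For `u = D′∕D` (coordinatewise; a fixed unit vector since all `|Dᵢ| = |D′ᵢ| = |ϖ|^{−2ρ}`,
§1): `u₂ − u₁ = (P′∕P)(f − f′)∕(Nζ+f)`, so (b) ⟺ `|f − f′| ≤ |ϖ|^{ρ+1}` — this is ⟹ and half of ⟸.  The point of ⟸ is that (c′) is then AUTOMATIC: with `W := g + Nx(Nζ+f) − Ny = D₀∕P`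
(a unit), `g_ℓ(u₂−u₁) + (u₂−u₀) = (P′∕P)·[(f−f′)(g_ℓW + Nx(Nζ+f)) + (g−g′)(Nζ+f)] ∕ (W(Nζ+f))`, and (α) `|g − g′| ≤ |ϖ|^{2ρ+1}` (the two (COF) congruences: `fg ≡ −BσB`,
`f′g′ ≡ −B′σB′`, `B′ = B + σx(f−f′)`), (β) `|g_ℓW + Nx(Nζ+f)| ≤ |ϖ|^ρ` (`y″(g_ℓW + Nx(Nζ+f)) = y″g_ℓg − xyB − ε(σy·y″ + xB)`, `ε := g_ℓy″ − xζ ∈ 𝔭^ρ`, using `σx(Nζ+f) = ζσy − B`).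
* §1 `letters_and_v_of_mem_Delta2` — the letters of a polarisation with ALL THREE `|Dᵢ| = |ϖ|^{−2ρ}` (via (A) + (B)).
* §2 `v_sub_letters_g_le` (α) and `v_lineariser_mul_W_add_le` (β).
* §3 HEAD **`exists_mem_fixedUnitStabilizer_iff_v_sub_le`** — the relatedness criterion.
HONEST LABEL.  Count-neutral; the census laws stay PROVER TARGETS until the MS assembly lands; `HC_CM` is proved only modulo the 7 printed citations (2 remaining named inputs:
hLiu418 = `stmt-HodgeConjecture-24832`, h413 = `stmt-HodgeConjecture-24833`) until rung 0 closes.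

## References
* [Jacobowitz1962] R. Jacobowitz, *Hermitian forms over local fields*, Amer. J. Math. 84 (1962), §4, §7 (Gram matrices, modular lattices).
* [Kottwitz1986BaseChangeUnits] R. Kottwitz, *Base change for unit elements of Hecke algebras*, Compositio Math. 60 (1986), §1 pp. 240–241 (fixed-lattice counting modulo the torus).
* [Serre1979] J.-P. Serre, *Local Fields*, GTM 67, Springer (1979), Ch. IV §2 Prop. 6 (the unit filtration `U^{(n)}`).
-/

set_option autoImplicit false

noncomputable section

namespace Summit.HodgeConjecture.HodgeConjecture.Cruxes.H413.F0P3cDyRamDiagonalCoreHangingPolarisationClassesTypeTwo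

open Matrix
open Literature.NumberTheory.Automorphic Literature.NumberTheory.Automorphic.HermitianLattice Literature.NumberTheory.Automorphic.UnitaryGroup
open Literature.NumberTheory.Automorphic.UnitaryLatticeTree
open Summit.HodgeConjecture.HodgeConjecture.Cruxes.H413.F0P3cDyRamDiagonalTorusDefs
open Summit.HodgeConjecture.HodgeConjecture.Cruxes.H413.F0P3cDyRamDiagonalGluedTubeCriterion
open Summit.HodgeConjecture.HodgeConjecture.Cruxes.H413.F0P3cDyRamDiagonalGluedFixedStabiliser
open Summit.HodgeConjecture.HodgeConjecture.Cruxes.H413.F0P3cDyRamDiagonalGluedStabiliserIndex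
open Summit.HodgeConjecture.HodgeConjecture.Cruxes.H413.F0P3cDyRamDiagonalGluedStabiliserIndexCorner
open Summit.HodgeConjecture.HodgeConjecture.Cruxes.H413.F0P3cDyRamDiagonalCoreHangingPolarisationsTypeTwo
open Summit.HodgeConjecture.HodgeConjecture.Cruxes.H413.F0P3cDyRamDiagonalCoreHangingCriterionTypeTwo
open scoped Valued WithZero Matrix MatrixGroups

variable {K : Type*} [Field K] [Valued K ℤᵐ⁰]

/-! ## §1  The letters of a member of `Δ₂`, with all three valuations -/

/-- **THE LETTERS OF A TYPE-2 POLARISATION, WITH `|D₀| = |D₁| = |D₂| = |ϖ|^{−2ρ}`** (ramified datum letters; (B) `isVertexLattice_two_latt_coreHanging_iff` ⟹ the three conditions,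
then (B) `isVertexLattice_two_latt_coreHanging_of_letters` read back on `D = (D₀, D₁, D₂)` gives the valuations): `σf = f`, `σg = g`, `|D₂| = |ϖ|^{−2ρ}`, (R), (COF), `∀ i, |Dᵢ| = |ϖ|^{−2ρ}`,
where `f := −(D₁ + D₂Nζ)∕D₂`, `g := (D₀ + Nx·D₁ + Ny·D₂)∕D₂`. [cite: Jacobowitz1962, §7] [cite: Kottwitz1986BaseChangeUnits, §1 pp. 240–241] -/
theorem letters_and_v_of_mem_Delta2 {σ : K →+* K} (hσ : ∀ a, σ (σ a) = a) (hvσ : ∀ a, Valued.v (σ a) = Valued.v a)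
    (hfix : ∀ x : K, σ x = x → x ≠ 0 → ∃ n : ℤ, Valued.v x = WithZero.exp (2 * n)) {ϖ : K} (hϖ : Valued.v ϖ = WithZero.exp (-1 : ℤ))
    (hTr : ∀ a : K, Valued.v (a + σ a) ≤ Valued.v ϖ * Valued.v a)
    (ρ : ℕ) (hρ : 1 ≤ ρ) {x ζ y'' : K} (hx : Valued.v x = 1) (hζ : Valued.v ζ = 1) (hy'' : Valued.v y'' = 1) (hy : Valued.v (x * ζ + y'') = 1)
    (V : GL (Fin 3) K) (hV : (V : Matrix (Fin 3) (Fin 3) K) = !![1, 0, 0; x, ϖ ^ ρ, 0; x * ζ + y'', ϖ ^ ρ * ζ, ϖ ^ (2 * ρ + 1)])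
    {D : Fin 3 → K} (hD : ∀ i, σ (D i) = D i ∧ D i ≠ 0) (hvert : IsVertexLattice σ ϖ (Matrix.diagonal D) 2 (latt (V : Matrix (Fin 3) (Fin 3) K)))
    {f g : K} (hf : f = -(D 1 + D 2 * (ζ * σ ζ)) / D 2) (hg : g = (D 0 + σ x * D 1 * x + σ (x * ζ + y'') * D 2 * (x * ζ + y'')) / D 2) :
    σ f = f ∧ σ g = g ∧ Valued.v (D 2) = (Valued.v ϖ ^ (2 * ρ))⁻¹ ∧ Valued.v (ζ * σ y'' - σ x * f) ≤ Valued.v ϖ ^ ρ ∧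
      Valued.v (f * g + (ζ * σ y'' - σ x * f) * (σ ζ * y'' - x * f)) ≤ Valued.v ϖ ^ (2 * ρ + 1) ∧
      D 1 = -(D 2 * (ζ * σ ζ + f)) ∧ D 0 = D 2 * g - (σ x * D 1 * x + σ (x * ζ + y'') * D 2 * (x * ζ + y'')) ∧
      ∀ i, Valued.v (D i) = (Valued.v ϖ ^ (2 * ρ))⁻¹ := by
  obtain ⟨hϖ0, hϖ1⟩ := ne_zero_and_v_lt_one_of_v_eq_exp hϖ
  obtain ⟨hvP, hR, hcof⟩ := (isVertexLattice_two_latt_coreHanging_iff hσ hvσ hfix hϖ hTr ρ hρ hx hζ hy'' hy V hV hD).1 hvert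
  rw [← hf] at hR hcof; rw [← hg] at hcof
  have hD2 : D 2 ≠ 0 := (hD 2).2
  have hσf : σ f = f := by
    rw [hf, map_div₀, map_neg, map_add, map_mul, map_mul, hσ, (hD 1).1, (hD 2).1, mul_comm (σ ζ) ζ]
  have hσg : σ g = g := by
    rw [hg, map_div₀, map_add, map_add, map_mul, map_mul, map_mul, map_mul, hσ, hσ, (hD 0).1, (hD 1).1, (hD 2).1]
    congr 1; ring
  have hD₁ : D 1 = -(D 2 * (ζ * σ ζ + f)) := by rw [hf]; field_simp; ring
  have hD₀ : D 0 = D 2 * g - (σ x * D 1 * x + σ (x * ζ + y'') * D 2 * (x * ζ + y'')) := by rw [hg]; field_simp; ring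
  have h := (isVertexLattice_two_latt_coreHanging_of_letters hσ hvσ hϖ0 hϖ1 hTr ρ hρ hx hζ hy'' hy V hV (hD 2).1 hvP hσf hR hσg hcof hD₁ hD₀).2.1
  refine ⟨hσf, hσg, hvP, hR, hcof, hD₁, hD₀, fun i => ?_⟩
  fin_cases i
  · exact h 0
  · exact h 1
  · exact h 2

/-! ## §2  The two estimates (α), (β) -/

/-- **(α) THE LETTER `g` IS DETERMINED MODULO `𝔭^{2ρ+1}` BY `f` MODULO `𝔭^{ρ+1}`**: if `(f, g)` and `(f′, g′)` both satisfy (COF) with (R) for `f` and `|f − f′| ≤ |ϖ|^{ρ+1}`, then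
`|g − g′| ≤ |ϖ|^{2ρ+1}` (`fg − f′g′ ≡ B′σB′ − BσB = (f−f′)(xB + σxσB + Nx(f−f′))`, `|f| = 1`, `|g′| ≤ |ϖ|^{2ρ}`). [cite: Jacobowitz1962, §7] [cite: Kottwitz1986BaseChangeUnits, §1 pp. 240–241] -/
theorem v_sub_letters_g_le {σ : K →+* K} (hσ : ∀ a, σ (σ a) = a) (hvσ : ∀ a, Valued.v (σ a) = Valued.v a)
    {ϖ : K} (hϖ1 : Valued.v ϖ < 1) (ρ : ℕ) (hρ : 1 ≤ ρ) {x ζ y'' : K} (hx : Valued.v x = 1) (hζ : Valued.v ζ = 1) (hy'' : Valued.v y'' = 1)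
    {f g f' g' : K} (hf : σ f = f) (hf' : σ f' = f') (hR : Valued.v (ζ * σ y'' - σ x * f) ≤ Valued.v ϖ ^ ρ)
    (hcof : Valued.v (f * g + (ζ * σ y'' - σ x * f) * (σ ζ * y'' - x * f)) ≤ Valued.v ϖ ^ (2 * ρ + 1))
    (hR' : Valued.v (ζ * σ y'' - σ x * f') ≤ Valued.v ϖ ^ ρ)
    (hcof' : Valued.v (f' * g' + (ζ * σ y'' - σ x * f') * (σ ζ * y'' - x * f')) ≤ Valued.v ϖ ^ (2 * ρ + 1))
    (hff' : Valued.v (f - f') ≤ Valued.v ϖ ^ (ρ + 1)) :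
    Valued.v (g - g') ≤ Valued.v ϖ ^ (2 * ρ + 1) := by
  have hϖ1' : Valued.v ϖ ≤ 1 := hϖ1.le
  have hϖρ1 : Valued.v ϖ ^ ρ < 1 := pow_lt_one₀ zero_le hϖ1 (by omega)
  set B : K := ζ * σ y'' - σ x * f with hB
  set B' : K := ζ * σ y'' - σ x * f' with hB'
  -- `|f| = |f′| = 1`
  have h1 : Valued.v (ζ * σ y'') = 1 := by rw [map_mul, hζ, hvσ, hy'', one_mul]
  have hunit : ∀ {φ : K}, Valued.v (ζ * σ y'' - σ x * φ) ≤ Valued.v ϖ ^ ρ → Valued.v φ = 1 := fun {φ} hφ => by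
    have hlt : Valued.v (ζ * σ y'' - σ x * φ) < 1 := hφ.trans_lt hϖρ1
    have hvxf : Valued.v (σ x * φ) = 1 := by
      have e : σ x * φ = ζ * σ y'' + -(ζ * σ y'' - σ x * φ) := by ring
      rw [e, Valuation.map_add_eq_of_lt_left _ (by rwa [Valuation.map_neg, h1]), h1]
    rw [map_mul, hvσ, hx, one_mul] at hvxf; exact hvxf
  have hvf : Valued.v f = 1 := hunit hR
  have hvf' : Valued.v f' = 1 := hunit hR'
  -- `σB`, `σB′`
  have hσB : σ B = σ ζ * y'' - x * f := by rw [hB, map_sub, map_mul, map_mul, hσ, hσ, hf]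
  have hσBv : Valued.v (σ ζ * y'' - x * f) = Valued.v B := by rw [← hσB, hvσ]
  -- `|g′| ≤ |ϖ|^{2ρ}`
  have hvBB' : Valued.v (B' * (σ ζ * y'' - x * f')) ≤ Valued.v ϖ ^ (2 * ρ) := by
    have hσB' : σ B' = σ ζ * y'' - x * f' := by rw [hB', map_sub, map_mul, map_mul, hσ, hσ, hf']
    have hσB'v : Valued.v (σ ζ * y'' - x * f') = Valued.v B' := by rw [← hσB', hvσ]
    rw [map_mul, hσB'v, show 2 * ρ = ρ + ρ by ring, pow_add]; exact mul_le_mul' hR' hR'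
  have hvg' : Valued.v g' ≤ Valued.v ϖ ^ (2 * ρ) := by
    have hf'0 : f' ≠ 0 := fun h => by rw [h, map_zero] at hvf'; exact zero_ne_one hvf'
    have e : g' = f'⁻¹ * ((f' * g' + B' * (σ ζ * y'' - x * f')) - B' * (σ ζ * y'' - x * f')) := by field_simp; ring
    rw [e, map_mul, map_inv₀, hvf', inv_one, one_mul]
    exact v_sub_le_of_le (hcof'.trans (by rw [pow_succ]; exact mul_le_of_le_one_right' hϖ1')) hvBB'
  -- `B′σB′ − BσB = (f − f′)(xB + σxσB + Nx(f − f′))`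
  have hdiff : B' * (σ ζ * y'' - x * f') - B * (σ ζ * y'' - x * f) = (f - f') * (x * B + σ x * (σ ζ * y'' - x * f) + σ x * x * (f - f')) := by
    rw [hB, hB']; ring
  have hvdiff : Valued.v (B' * (σ ζ * y'' - x * f') - B * (σ ζ * y'' - x * f)) ≤ Valued.v ϖ ^ (2 * ρ + 1) := by
    rw [hdiff, map_mul, show 2 * ρ + 1 = (ρ + 1) + ρ by ring, pow_add]
    refine mul_le_mul' hff' ((Valuation.map_add _ _ _).trans (max_le ((Valuation.map_add _ _ _).trans (max_le ?_ ?_)) ?_))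
    · rw [map_mul, hx, one_mul]; exact hR
    · rw [map_mul, hvσ, hx, one_mul, hσBv]; exact hR
    · rw [map_mul, map_mul, hvσ, hx, one_mul, one_mul]
      exact hff'.trans (pow_le_pow_right_of_le_one' hϖ1' (by omega))
  -- `fg − f′g′`
  have hvfg : Valued.v (f * g - f' * g') ≤ Valued.v ϖ ^ (2 * ρ + 1) := by
    have e : f * g - f' * g' = (f * g + B * (σ ζ * y'' - x * f)) - (f' * g' + B' * (σ ζ * y'' - x * f')) + (B' * (σ ζ * y'' - x * f') - B * (σ ζ * y'' - x * f)) := by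
      ring
    rw [e]
    exact (Valuation.map_add _ _ _).trans (max_le (v_sub_le_of_le hcof hcof') hvdiff)
  -- `f(g − g′) = (fg − f′g′) − (f − f′)g′`
  have e : g - g' = f⁻¹ * ((f * g - f' * g') - (f - f') * g') := by
    have hf0 : f ≠ 0 := fun h => by rw [h, map_zero] at hvf; exact zero_ne_one hvf
    field_simp; ring
  rw [e, map_mul, map_inv₀, hvf, inv_one, one_mul]
  refine v_sub_le_of_le hvfg ?_
  rw [map_mul, show 2 * ρ + 1 = (ρ + 1) + ρ by ring, pow_add]
  exact mul_le_mul' hff' (hvg'.trans (pow_le_pow_right_of_le_one' hϖ1' (by omega)))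

/-- **(β) THE LINEARISER AGAINST THE UNIT `W = D₀∕P`**: with `g_ℓ` a fixed lineariser (`|g_ℓ| = 1`, `|xζ − g_ℓ·y″| ≤ |ϖ|^ρ`), (R) for `f` and `|g| ≤ |ϖ|^{2ρ}`,
`|g_ℓ·(g + Nx(Nζ+f) − Ny) + Nx(Nζ+f)| ≤ |ϖ|^ρ` — because `y″·(…) = y″g_ℓg − xyB − ε(σy·y″ + xB)` with `ε := g_ℓy″ − xζ`, using `σx(Nζ+f) = ζσy − B`.
[cite: Kottwitz1986BaseChangeUnits, §1 pp. 240–241] -/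
theorem v_lineariser_mul_W_add_le {σ : K →+* K} (hvσ : ∀ a, Valued.v (σ a) = Valued.v a)
    {ϖ : K} (hϖ1 : Valued.v ϖ ≤ 1) (ρ : ℕ) (hρ : 1 ≤ ρ) {x ζ y'' : K} (hx : Valued.v x = 1) (hy'' : Valued.v y'' = 1)
    (hy : Valued.v (x * ζ + y'') = 1) {f g gl : K} (hR : Valued.v (ζ * σ y'' - σ x * f) ≤ Valued.v ϖ ^ ρ) (hvg : Valued.v g ≤ Valued.v ϖ ^ (2 * ρ))
    (hvgl : Valued.v gl = 1) (hlin : Valued.v (x * ζ - gl * y'') ≤ Valued.v ϖ ^ ρ) :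
    Valued.v (gl * (g + σ x * x * (ζ * σ ζ + f) - σ (x * ζ + y'') * (x * ζ + y'')) + σ x * x * (ζ * σ ζ + f)) ≤ Valued.v ϖ ^ ρ := by
  set y : K := x * ζ + y'' with hy0
  set B : K := ζ * σ y'' - σ x * f with hB
  set ε : K := gl * y'' - x * ζ with hε
  have hvε : Valued.v ε ≤ Valued.v ϖ ^ ρ := by rw [hε, ← Valuation.map_neg, neg_sub]; exact hlin
  have hkey : σ x * (ζ * σ ζ + f) = ζ * σ y - B := by rw [hy0, hB, map_add, map_mul]; ring
  have hid : y'' * (gl * (g + σ x * x * (ζ * σ ζ + f) - σ y * y) + σ x * x * (ζ * σ ζ + f)) =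
      y'' * gl * g - x * y * B - ε * (σ y * y'' + x * B) := by
    have e1 : σ x * x * (ζ * σ ζ + f) = x * (ζ * σ y - B) := by rw [← hkey]; ring
    rw [e1, hε, hy0]
    ring
  have hvy''pos : (0 : ℤᵐ⁰) < Valued.v y'' := by rw [hy'']; exact zero_lt_one
  have h : Valued.v (y'' * (gl * (g + σ x * x * (ζ * σ ζ + f) - σ y * y) + σ x * x * (ζ * σ ζ + f))) ≤ Valued.v ϖ ^ ρ := by
    rw [hid]
    refine v_sub_le_of_le (v_sub_le_of_le ?_ ?_) ?_
    · rw [map_mul, map_mul, hy'', hvgl, one_mul, one_mul]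
      exact hvg.trans (pow_le_pow_right_of_le_one' hϖ1 (by omega))
    · rw [map_mul, map_mul, hx, hy, one_mul, one_mul]; exact hR
    · rw [map_mul]
      refine (mul_le_mul' hvε ((Valuation.map_add _ _ _).trans (max_le ?_ ?_))).trans_eq (mul_one _)
      · rw [map_mul, hvσ, hy, hy'', one_mul]
      · rw [map_mul, hx, one_mul]; exact hR.trans (pow_le_one₀ zero_le hϖ1)
  rw [map_mul, hy'', one_mul] at h
  exact h

/-! ## §3  HEAD — the relatedness criterion -/

/-- **B7₂ (ii)₂ — TWO TYPE-2 POLARISATIONS OF THE CORE-HANGING FRAME ARE `S_F`-RELATED IFF `|D₁∕D₂ − D′₁∕D′₂| ≤ |ϖ|^{ρ+1}`.**  Ramified quadratic datum letters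
(`σ` an involution with `|σ·| = |·|`, fixed elements of even valuation, `|ϖ| = exp(−1)`, `|ϖ − σϖ| = |ϖ|^d`, the wild trace bound), a finite residue field, `ρ ≥ 1`, units `x, ζ, y″, xζ+y″`,
`V = (1 0 0; x ϖ^ρ 0; xζ+y″ ϖ^ρζ ϖ^{2ρ+1})`; `D, D′` non-degenerate `σ`-fixed diagonal forms of which `latt V` is a type-2 vertex.  Then
`(∃ u ∈ S_F(latt V), D′ = D·u) ⟺ |D₁∕D₂ − D′₁∕D′₂| ≤ |ϖ|^{ρ+1}` — ⟹ is (b) of ★ `mem_fixedUnitStabilizer_latt_glued_corner_iff` (`s = 0`, `e = 1`); for ⟸ take `u := D′∕D`, then (b) holds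
and (c′) follows from §2 (α)(β). [cite: Kottwitz1986BaseChangeUnits, §1 pp. 240–241] [cite: Serre1979, Ch. IV §2 Prop. 6] -/
theorem exists_mem_fixedUnitStabilizer_iff_v_sub_le {σ : K →+* K} (hσ : ∀ a, σ (σ a) = a) (hvσ : ∀ a, Valued.v (σ a) = Valued.v a)
    (hfix : ∀ x : K, σ x = x → x ≠ 0 → ∃ n : ℤ, Valued.v x = WithZero.exp (2 * n)) {ϖ : K} (hϖ : Valued.v ϖ = WithZero.exp (-1 : ℤ))
    (hTr : ∀ a : K, Valued.v (a + σ a) ≤ Valued.v ϖ * Valued.v a)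
    (ρ : ℕ) (hρ : 1 ≤ ρ) {x ζ y'' : K} (hx : Valued.v x = 1) (hζ : Valued.v ζ = 1) (hy'' : Valued.v y'' = 1) (hy : Valued.v (x * ζ + y'') = 1)
    (V : GL (Fin 3) K) (hV : (V : Matrix (Fin 3) (Fin 3) K) = !![1, 0, 0; x, ϖ ^ ρ, 0; x * ζ + y'', ϖ ^ ρ * ζ, ϖ ^ (2 * ρ + 1)])
    {D D' : Fin 3 → K} (hD : ∀ i, σ (D i) = D i ∧ D i ≠ 0) (hvert : IsVertexLattice σ ϖ (Matrix.diagonal D) 2 (latt (V : Matrix (Fin 3) (Fin 3) K)))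
    (hD' : ∀ i, σ (D' i) = D' i ∧ D' i ≠ 0) (hvert' : IsVertexLattice σ ϖ (Matrix.diagonal D') 2 (latt (V : Matrix (Fin 3) (Fin 3) K))) :
    (∃ u ∈ fixedUnitStabilizer σ (latt (V : Matrix (Fin 3) (Fin 3) K)), ∀ i, D' i = D i * (u i : K)) ↔
      Valued.v (D 1 / D 2 - D' 1 / D' 2) ≤ Valued.v ϖ ^ (ρ + 1) := by
  obtain ⟨hϖ0, hϖ1⟩ := ne_zero_and_v_lt_one_of_v_eq_exp hϖ
  have hvϖ : 0 < Valued.v ϖ := (Valuation.pos_iff _).2 hϖ0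
  set E2 : ℤᵐ⁰ := Valued.v ϖ ^ (2 * ρ) with hE2
  have hE20 : E2 ≠ 0 := pow_ne_zero _ hvϖ.ne'
  -- the letters of `D` and `D′`
  set f : K := -(D 1 + D 2 * (ζ * σ ζ)) / D 2 with hf
  set g : K := (D 0 + σ x * D 1 * x + σ (x * ζ + y'') * D 2 * (x * ζ + y'')) / D 2 with hg
  set f' : K := -(D' 1 + D' 2 * (ζ * σ ζ)) / D' 2 with hf'
  set g' : K := (D' 0 + σ x * D' 1 * x + σ (x * ζ + y'') * D' 2 * (x * ζ + y'')) / D' 2 with hg'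
  obtain ⟨hσf, hσg, hvP, hR, hcof, hD₁, hD₀, hvD⟩ := letters_and_v_of_mem_Delta2 hσ hvσ hfix hϖ hTr ρ hρ hx hζ hy'' hy V hV hD hvert hf hg
  obtain ⟨hσf', -, hvP', hR', hcof', hD₁', hD₀', hvD'⟩ := letters_and_v_of_mem_Delta2 hσ hvσ hfix hϖ hTr ρ hρ hx hζ hy'' hy V hV hD' hvert' hf' hg'
  have hDne : ∀ i, D i ≠ 0 := fun i => (hD i).2
  have hD'ne : ∀ i, D' i ≠ 0 := fun i => (hD' i).2
  have hD2 : D 2 ≠ 0 := hDne 2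
  have hD'2 : D' 2 ≠ 0 := hD'ne 2
  -- unit letters
  set y : K := x * ζ + y'' with hydef
  set Nζ : K := ζ * σ ζ with hNζ
  set B : K := ζ * σ y'' - σ x * f with hB
  have hϖρ1 : Valued.v ϖ ^ ρ < 1 := pow_lt_one₀ zero_le hϖ1 (by omega)
  have h1 : Valued.v (ζ * σ y'') = 1 := by rw [map_mul, hζ, hvσ, hy'', one_mul]
  have hvxf : Valued.v (σ x * f) = 1 := by
    have e : σ x * f = ζ * σ y'' + -B := by rw [hB]; ring
    rw [e, Valuation.map_add_eq_of_lt_left _ (by rw [Valuation.map_neg, h1]; exact hR.trans_lt hϖρ1), h1]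
  have hvf : Valued.v f = 1 := by rw [map_mul, hvσ, hx, one_mul] at hvxf; exact hvxf
  have hf0 : f ≠ 0 := fun h => by rw [h, map_zero] at hvf; exact zero_ne_one hvf
  have hkey : σ x * (Nζ + f) = ζ * σ y + -B := by rw [hydef, hNζ, hB, map_add, map_mul]; ring
  have hvζσy : Valued.v (ζ * σ y) = 1 := by rw [map_mul, hζ, hvσ, hy, one_mul]
  have hvNf : Valued.v (Nζ + f) = 1 := by
    have h' : Valued.v (σ x * (Nζ + f)) = 1 := by
      rw [hkey, Valuation.map_add_eq_of_lt_left _ (by rw [Valuation.map_neg, hvζσy]; exact hR.trans_lt hϖρ1), hvζσy]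
    rw [map_mul, hvσ, hx, one_mul] at h'; exact h'
  have hNf0 : Nζ + f ≠ 0 := fun h => by rw [h, map_zero] at hvNf; exact zero_ne_one hvNf
  -- `W = D₀∕P` is a unit
  set W : K := g + σ x * x * (Nζ + f) - σ y * y with hW
  have hD₀W : D 0 = D 2 * W := by rw [hW, hD₀, hD₁]; ring
  have hvW : Valued.v W = 1 := by
    have h := hvD 0
    rw [hD₀W, map_mul, hvP] at h
    have := mul_left_cancel₀ (inv_ne_zero hE20) (h.trans (mul_one _).symm)
    exact this
  have hW0 : W ≠ 0 := fun h => by rw [h, map_zero] at hvW; exact zero_ne_one hvW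
  set W' : K := g' + σ x * x * (Nζ + f') - σ y * y with hW'
  have hD₀W' : D' 0 = D' 2 * W' := by rw [hW', hD₀', hD₁']; ring
  -- the lineariser `g_ℓ = Nζ∕f` and the stabiliser
  have hy''0 : Valued.v y'' = Valued.v ϖ ^ 0 := by rw [pow_zero]; exact hy''
  have hR0 : Valued.v (ζ * σ y'' - σ x * f) ≤ Valued.v ϖ ^ (ρ + 0) := by rw [Nat.add_zero]; exact hR
  obtain ⟨-, -, hgl1, hlin⟩ := lineariser_of_criterionR hσ hvσ hϖ0 hϖ1 hρ 0 hx hζ hy''0 hσf hR0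
  have hvgl : Valued.v (ζ * σ ζ * f⁻¹) = 1 := by have h := hgl1; rw [pow_zero, mul_one] at h; exact h
  have hV0 : (V : Matrix (Fin 3) (Fin 3) K) = !![1, 0, 0; x, ϖ ^ ρ, 0; x * ζ + y'', ϖ ^ ρ * ζ, ϖ ^ (2 * ρ + 0 + 1)] := by rw [Nat.add_zero]; exact hV
  have hSF : ∀ {u : Fin 3 → Kˣ}, u ∈ fixedUnitTorus σ 3 → (u ∈ fixedUnitStabilizer σ (latt (V : Matrix (Fin 3) (Fin 3) K)) ↔
      Valued.v ((u 2 : K) - u 1) ≤ Valued.v ϖ ^ (ρ + 1) ∧ Valued.v (ζ * σ ζ * f⁻¹ * ((u 2 : K) - u 1) + ((u 2 : K) - u 0)) ≤ Valued.v ϖ ^ (2 * ρ + 1)) := fun {u} hu => by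
    have h := mem_fixedUnitStabilizer_latt_glued_corner_iff hϖ0 hϖ1.le ρ 0 1 hx hζ hy''0 hgl1.le hlin V hV0 hu
    rwa [Nat.add_zero, Nat.add_zero] at h
  -- the ratio identity behind (b)
  have hratio : ∀ {u₁ u₂ : K}, D' 1 = D 1 * u₁ → D' 2 = D 2 * u₂ → Valued.v (D 1 / D 2 - D' 1 / D' 2) = Valued.v (u₂ - u₁) := fun {u₁ u₂} h1 h2 => by
    have hu₂ : Valued.v u₂ = 1 := by
      have h := hvD' 2; rw [h2, map_mul, hvP] at h
      exact mul_left_cancel₀ (inv_ne_zero hE20) (h.trans (mul_one _).symm)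
    have hu₂0 : u₂ ≠ 0 := fun h => by rw [h, map_zero] at hu₂; exact zero_ne_one hu₂
    have e : D 1 / D 2 - D' 1 / D' 2 = (D 1 / D 2) * u₂⁻¹ * (u₂ - u₁) := by rw [h1, h2]; field_simp
    rw [e, map_mul, map_mul, map_div₀, hvD 1, hvD 2, div_self (inv_ne_zero hE20), map_inv₀, hu₂, inv_one, mul_one, one_mul]
  constructor
  · -- ⟹ : (b)
    rintro ⟨u, hu, hDu⟩
    have hu𝒰 : u ∈ fixedUnitTorus σ 3 := (Subgroup.mem_inf.1 hu).2
    obtain ⟨hb, -⟩ := (hSF hu𝒰).1 hu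
    rw [hratio (hDu 1) (hDu 2)]
    exact hb
  · -- ⟸ : `u := D′∕D` satisfies (b) and (c′)
    intro hff
    let u : Fin 3 → Kˣ := fun i => Units.mk0 (D' i / D i) (div_ne_zero (hD'ne i) (hDne i))
    have hu : ∀ i, (u i : K) = D' i / D i := fun i => rfl
    have hDu : ∀ i, D' i = D i * (u i : K) := fun i => by rw [hu, mul_div_cancel₀ _ (hDne i)]
    have hu𝒰 : u ∈ fixedUnitTorus σ 3 := by
      refine (mem_fixedUnitTorus_iff σ u).2 ⟨fun i => ?_, fun i => ?_⟩
      · rw [hu, map_div₀, hvD i, hvD' i, div_self (inv_ne_zero hE20)]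
      · rw [hu, map_div₀, (hD i).1, (hD' i).1]
    refine ⟨u, (hSF hu𝒰).2 ⟨?_, ?_⟩, hDu⟩
    · -- (b)
      rw [← hratio (hDu 1) (hDu 2)]; exact hff
    · -- (c′)
      -- `|f − f′| ≤ |ϖ|^{ρ+1}`
      have hff' : Valued.v (f - f') ≤ Valued.v ϖ ^ (ρ + 1) := by
        have e : f - f' = -(D 1 / D 2 - D' 1 / D' 2) := by rw [hf, hf']; field_simp; ring
        rw [e, Valuation.map_neg]; exact hff
      -- (α) and (β)
      have hα := v_sub_letters_g_le hσ hvσ hϖ1 ρ hρ hx hζ hy'' hσf hσf' hR hcof hR' hcof' hff'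
      have hvBB : Valued.v (B * (σ ζ * y'' - x * f)) ≤ E2 := by
        have hσB : σ B = σ ζ * y'' - x * f := by rw [hB, map_sub, map_mul, map_mul, hσ, hσ, hσf]
        have hσBv : Valued.v (σ ζ * y'' - x * f) = Valued.v B := by rw [← hσB, hvσ]
        rw [map_mul, hσBv, hE2, show 2 * ρ = ρ + ρ by ring, pow_add]; exact mul_le_mul' hR hR
      have hvg : Valued.v g ≤ E2 := by
        have e : g = f⁻¹ * ((f * g + B * (σ ζ * y'' - x * f)) - B * (σ ζ * y'' - x * f)) := by field_simp; ring
        rw [e, map_mul, map_inv₀, hvf, inv_one, one_mul]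
        exact v_sub_le_of_le (hcof.trans (by rw [hE2, pow_succ]; exact mul_le_of_le_one_right' hϖ1.le)) hvBB
      have hβ := v_lineariser_mul_W_add_le hvσ hϖ1.le ρ hρ hx hy'' hy hR hvg hvgl hlin
      rw [← hydef, ← hNζ, ← hW] at hβ
      -- the identity for `g_ℓ(u₂ − u₁) + (u₂ − u₀)`
      have hu2 : (u 2 : K) = D' 2 / D 2 := hu 2
      have hu1 : (u 1 : K) = D' 2 / D 2 * ((Nζ + f') / (Nζ + f)) := by rw [hu, hD₁, hD₁', neg_div_neg_eq, mul_div_mul_comm]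
      have hu0 : (u 0 : K) = D' 2 / D 2 * (W' / W) := by rw [hu, hD₀W, hD₀W', mul_div_mul_comm]
      have hW'eq : W' = W - ((g - g') + σ x * x * (f - f')) := by rw [hW, hW']; ring
      have hid : ζ * σ ζ * f⁻¹ * ((u 2 : K) - u 1) + ((u 2 : K) - u 0) =
          D' 2 / D 2 * (W * (Nζ + f))⁻¹ * ((f - f') * (ζ * σ ζ * f⁻¹ * W + σ x * x * (Nζ + f)) + (g - g') * (Nζ + f)) := by
        rw [hu2, hu1, hu0, hW'eq]
        field_simp
        ring
      rw [hid, map_mul, map_mul, map_div₀, hvD' 2, hvD 2, div_self (inv_ne_zero hE20), one_mul, map_inv₀, map_mul, hvW, hvNf, mul_one, inv_one, one_mul]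
      refine (Valuation.map_add _ _ _).trans (max_le ?_ ?_)
      · rw [map_mul, show 2 * ρ + 1 = (ρ + 1) + ρ by ring, pow_add]
        exact mul_le_mul' hff' hβ
      · rw [map_mul, hvNf, mul_one]; exact hα

end Summit.HodgeConjecture.HodgeConjecture.Cruxes.H413.F0P3cDyRamDiagonalCoreHangingPolarisationClassesTypeTwo

end
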